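import Mathlib.Analysis.SpecialFunctions.SmoothTransition
import Literature.Barriers.FinalStateConjecture.TrappingDerivativeLossInputs
import Literature.Geometry.Lorentzian.KerrFluxComparison
import Literature.Geometry.Lorentzian.KerrSchildCoord
import HarnessLib

/-!
# Sbierski's Kerr trapping theorem: the Gaussian-beam input in the source's own energy, and the
# coordinate-energy beam fact proved from it
(third companion file of `Literature/Barriers/FinalStateConjecture/TrappingDerivativeLoss.lean`;
family `gr`, summit `FinalStateConjecture`; namespace `Literature.Barriers.FinalStateConjecture`)

`TrappingDerivativeLossInputs.lean` reduces the localised solutions `SbierskiKerrLocalisedSolutions`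
(Sbierski, Anal. PDE 8 (2015), Thm. 5.1 with §7A) to two named facts: (A) the Cauchy problem with
the energy estimate (`KerrWaveCauchyEnergyEstimate`) and (B) Gaussian beams along the trapped null
geodesics of Kerr (`SbierskiKerrGaussianBeams`). Fact (B) is stated there in the *coordinate*
energies of `WeightedNorms.lean` with "comparability constants absorbed", for beams that are
moreover compactly supported in the chart ("the beam cut off smoothly in `t*` outside
`[−1, T + 1]`") and with Sbierski's accuracy `μ` already specialised to `ṫ*/2`. This file vendors
the beam input **in the form the source prints it** and **proves** (B) from it:

* `SbierskiKerrTrappedGeodesicBeams` — §7A: a trapped null geodesic `γ = γ_{r₀}` of the domain of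
  outer communications, `r₀ ∈ [r_δ, r_ρ]`, whose `N`-energy `e(τ) = −g(N, γ̇)|_{Im γ ∩ Σ_τ} = ṫ` is
  "bounded away from zero and infinity" (`c₁ ≤ e ≤ C₁`), `N = −(dt*)♯`; §3 (closing definition)
  and §4 (its theorem, with the third remark following it for real-valued beams): for every
  `T` and `μ > 0` a real Gaussian beam `u` along `γ`, supported in the prescribed neighbourhood
  `𝒩 = {|r − r₀| < η}` of `γ` (recorded as: `u = 0` off `{r ≥ r₊ + δ} ∩ {‖y‖ < R}`, `δ` fixed with
  `𝒩`, before `T`, `μ`), with initial `N`-energy *exactly* `e(0)`, with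
  `|E^N_τ(u) − e(τ)| < μ` for `0 ≤ τ ≤ T`, and (§3, second lemma, with the normalisation of the
  proof of Thm. 2.1) `‖□u‖²_{L²(R_{[0,T]})} ≤ μ`. Here `E^N_τ` **is** `Kerr.leafFlux M a 0 · τ` of
  `KerrHyperboloidalFlux.lean`: the future unit normal of the Kerr–Schild leaf `{t* = τ}` is
  `n = N/|N|` with `|N| = √(1 + 2H) = √(det ḡ_τ)`, so `J^N·n vol_ḡ = T(N, N) dy`, and
  `‖·‖²_{L²(R_{[0,T]})}` is `slabSqNorm` of the previous file (`|det g| = 1`).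
* `SbierskiKerrGaussianBeams.of_trappedGeodesicBeams :
  SbierskiKerrTrappedGeodesicBeams → SbierskiKerrGaussianBeams` — the steps the previous file
  absorbs, now machine-checked: (i) the smooth cut-off in `t*` outside `[−1, T + 1]` (Mathlib's
  `Real.smoothTransition`), giving a `C^∞` function of compact
  support in the chart (`{−2 ≤ t* ≤ T + 2} ∩ {‖y‖ ≤ R} ∩ {r ≥ r₊ + δ}` is compact and lies in
  `{r > r₊}`) which agrees with the beam near `{0 ≤ t* ≤ T}`, hence has the same `□` on the slab
  (**locality of `□_g`**, `dalembertian_congr_of_eventuallyEq`, from the chart formula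
  `Kerr.dalembertian_extend_eq_sum`) and the same energies through the leaves `0 ≤ τ ≤ T`
  (locality of `mfderiv`); (ii) the comparability of `E^N` with the coordinate energies on the
  whole exterior for `0 < M` and *any* `a`, the extremal case `a = M` of §7A included
  (`localLeafFlux_zero_height_le_localSliceEnergy_of_pos`, `H ≤ 1` on `{r > r₊}`,
  `r₊ ≥ M`; the tree's `KerrFluxComparison.lean` has the `|a| < M` versions), and the coercivity
  `sliceEnergy ≤ 4 · leafFlux` of the tree; (iii) "supp `ũ ⊆ 𝒩 ⊆ 𝒯`": a wave vanishing off the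
  cylinder has all its `N`-energy in the ball (`leafFlux_zero_height_eq_localLeafFlux`) and
  vanishing data outside it; (iv) `μ := min(c₁/2, ε)`, `c := c₁/30`, `C := 4C₁`.

Consequently `SbierskiKerrLocalisedSolutions`, `SbierskiTrappingObstruction` and
`SbierskiKerrTrappingLED` follow from (A) and the literal beam fact
(`SbierskiKerrLocalisedSolutions.of_cauchy_of_beams`, …), and the trust base of the barrier
on the beam side is the printed §3–§4/§7A statement. A further split of
`SbierskiKerrTrappedGeodesicBeams` into the §7A geodesic (an explicit curve; provable from the
separated geodesic equations once the chart form of the geodesic equation for `Kerr.smoothMetric`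
is available) and the §3–§4 beam theorem along a *given* null geodesic is the natural next layer.

## References

* J. Sbierski, *Characterisation of the energy of Gaussian beams on Lorentzian manifolds: with
  applications to black hole spacetimes*, Anal. PDE 8 (2015) 1379–1420 (arXiv:1311.2477): §2,
  proof of Thm. 2.1 (the three conditions on `u_λ`, the normalisation `ũ_λ = u_λ/√(E^N_0(u_λ))`,
  `‖□ũ_λ‖ → 0`) and the second remark following it (real parts) [arXiv Thm. 1, Remarks 2–3];
  §3 (second lemma: the three conditions from the structure functions; closing definition:
  `u_{λ,𝒩}`, `ũ_{λ,𝒩}` "with initial `N`-energy `E`") [arXiv Lemma 5, Def. 6]; §4 (its theorem and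
  the third remark following it) [arXiv Thm. 7]; Thm. 5.1 [arXiv Thm. 8]; §7A [arXiv §3.2.1,
  pp. 26–27]; Thm. 7.4 [arXiv Thm. 14]. Journal numbers as in the parent files; bracketed
  numbers are those of the held arXiv text.
* M. Dafermos, I. Rodnianski, Y. Shlapentokh-Rothman, arXiv:1402.7034, §3.1 (comparability of
  `J^N`-fluxes with coordinate energies, display following (23)).
-/

noncomputable section

open Set Filter Topology MeasureTheory
open scoped Manifold ContDiff ENNReal

namespace Literature.Barriers.FinalStateConjecture

open Literature.Geometry.Lorentzian

/-! ### The beam input in the source's energy -/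

/-- **Gaussian beams along a trapped null geodesic of Kerr, with the energy characterisation, in
Sbierski's `N`-energy** (named fact; the approximate-solution input of Thm. 5.1 for the geodesics
of §7A). Sbierski, Anal. PDE 8 (2015): (§7A) in the domain of outer communications of Kerr,
`0 ≤ a ≤ m`, `m ≠ 0`, foliated by `t* = v₊ − r` with `N = −(dt*)♯`, "there are trapped null
geodesics […] whose energy stays bounded away from zero and infinity", namely `γ = γ_{r₀}` on
`{r = r₀}`, `r₀ ∈ [r_δ, r_ρ]`, with `−(N, γ̇) = ṫ = ρ⁻²[a𝔻(θ) + (r₀² + a²)ℙ(r₀)/Δ(r₀)]` strictly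
positive and taking its minimum and maximum; (§3, closing definition) for structure functions
`a, φ` along `γ` the Gaussian beam `u_{λ,𝒩} = a_𝒩 e^{iλφ}`, `a_𝒩 = a χ_𝒩`, `supp χ_𝒩 ⊆ 𝒩`, and
`ũ_{λ,𝒩} = u_{λ,𝒩} √E / √(E^N_0(u_{λ,𝒩}))`, "a Gaussian beam along `γ` […] with initial `N`-energy
`E`"; (§3, second lemma, with the three conditions of the proof of Thm. 2.1)
`‖□u_λ‖_{L²(R_{[0,T]})} ≤ C(T)`, `E^N_0(u_λ) ≥ C(λ^{1/2} − 1) → ∞`, `u_λ` supported in `𝒩`, whence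
`‖□ũ_λ‖_{L²(R_{[0,T]})} → 0` for `λ → ∞` (proof of Thm. 2.1); (§4, its theorem) for
`γ : [0, S) → M` affinely parametrised future directed null with `γ(0) ∈ Σ₀`: "For any `T > 0`
with `Im(γ) ∩ Σ_T ≠ ∅` and for any `μ > 0` there exists a neighbourhood `𝒩₀` of `γ` and a
`λ₀ > 0` such that any Gaussian beam `ũ_{λ,𝒩}` along `γ` […] with parameters `λ ≥ λ₀` and `𝒩₀`,
and with initial `N`-energy equal to `−g(N, γ̇)|_{γ(0)}` satisfies
`|E^N_τ(ũ_{λ,𝒩₀}) − [−g(N, γ̇)|_{Im(γ) ∩ Σ_τ}]| < μ` for all `0 ≤ τ ≤ T`", where (its proof)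
`𝒩₀ = 𝒩₁(δ) ⊆ 𝒩` for any prescribed neighbourhood `𝒩` of `γ`, and (third remark) "by taking
the real or the imaginary part, one can also define a real valued Gaussian beam. The result […]
also holds true in this case". **Vendored form** (Kerr–Schild chart; `E^N_τ = Kerr.leafFlux M a 0`
and `‖□·‖²_{L²(R_{[0,T]})} = slabSqNorm`, module docstring; `e(τ)` stands for
`−g(N, γ̇)|_{Im γ ∩ Σ_τ}` of the chosen trapped `γ`, which meets every leaf `Σ_τ`, `τ ≥ 0`, `r`
being constant and `ṫ* = ṫ > 0` along it; the prescribed neighbourhood is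
`𝒩 = {|r − r₀| < η} ⊆ {r ≥ r₊ + δ} ∩ {‖y‖ < R}`, `‖y‖² ≤ r² + a²`): for `0 < M`, `0 ≤ a ≤ M`
there is `R₀` such that for every `R ≥ R₀` there are `e : ℝ → ℝ`, `0 < c₁ ≤ C₁` with
`c₁ ≤ e(τ) ≤ C₁` for `τ ≥ 0`, and `δ > 0`, such that for every `T ≥ 0` and `μ > 0` some
`u : Kerr.exterior M a → ℝ`, `C^∞` on the chart (the beam, cut off inside `D(Σ₀) ∩ {t* < 0}`
and extended by zero, module docstring of the previous file) and vanishing off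
`{r ≥ r₊ + δ} ∩ {‖y‖ < R}`, has `‖□u‖²_{L²(R_{[0,T]})} ≤ μ`, `E^N_0(u) = e(0)`, and `E^N_τ(u)`
finite with
`|E^N_τ(u) − e(τ)| < μ` for all `τ ∈ [0, T]`. Not provable from Mathlib/Literature at present (no
Gaussian beams, no Kerr geodesics); `SbierskiKerrGaussianBeams` is *derived* from it below.
[cite: Sbierski2015, §4 (theorem; third remark) with §3 (second lemma; closing def.) and §7A] -/
def SbierskiKerrTrappedGeodesicBeams : Prop :=
  ∀ [Kerr.Facts] [Kerr.SliceFacts] (M a : ℝ), 0 < M → 0 ≤ a → a ≤ M →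
    ∃ R₀ : ℝ, ∀ R : ℝ, R₀ ≤ R →
      ∃ (e : ℝ → ℝ) (c₁ C₁ δ : ℝ), 0 < c₁ ∧ 0 < δ ∧
        (∀ τ : ℝ, 0 ≤ τ → c₁ ≤ e τ ∧ e τ ≤ C₁) ∧
        ∀ T : ℝ, 0 ≤ T → ∀ μ : ℝ, 0 < μ →
          ∃ u : Kerr.exterior M a → ℝ,
            ContMDiff 𝓘(ℝ, E4) 𝓘(ℝ, ℝ) ∞ u ∧
            (∀ x : Kerr.exterior M a,
              R ≤ E4.spatialNorm (x : E4) ∨ Kerr.radius a x < Kerr.rPlus M a + δ → u x = 0) ∧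
            slabSqNorm (Kerr.exterior M a) (fun x ↦
                (Kerr.smoothMetric M a (Kerr.rPlus M a)).toPseudoRiemannianMetric.dalembertian u x)
              T ≤ ENNReal.ofReal μ ∧
            Kerr.leafFlux M a 0 u 0 = ENNReal.ofReal (e 0) ∧
            ∀ τ : ℝ, 0 ≤ τ → τ ≤ T →
              Kerr.leafFlux M a 0 u τ ≠ ⊤ ∧ |(Kerr.leafFlux M a 0 u τ).toReal - e τ| < μ

/-! ### Comparability of `E^N` with the coordinate energies for `0 < M` (any `a`) -/

/-- `0 < r₊` for `0 < M` (any `a`): `r₊ = M + √(M² − a²) ≥ M`. O'Neill 1995, Ch. 2, §2.3.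
[folklore] -/
theorem rPlus_pos_of_pos {M : ℝ} (hM : 0 < M) (a : ℝ) : 0 < Kerr.rPlus M a := by
  have := Real.sqrt_nonneg (M ^ 2 - a ^ 2)
  simp only [Kerr.rPlus]; linarith

/-- `H ≤ 1` on the exterior `{r > r₊}` for `0 < M` (any `a`; extremal case included):
`H = M r³/(r⁴ + a²z²) ≤ M/r < M/r₊ ≤ 1` as `r₊ = M + √(M² − a²) ≥ M`. The tree's
`Kerr.scalarH_le_one` assumes `|a| < M`. Visser arXiv:0706.0622, (33). [folklore] -/
theorem scalarH_le_one_of_pos {M a : ℝ} (hM : 0 < M) {x : E4}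
    (hx : x ∈ Kerr.region a (Kerr.rPlus M a)) : Kerr.scalarH M a x ≤ 1 := by
  have hr : Kerr.rPlus M a < Kerr.radius a x := (le_max_left _ _).trans_lt hx
  have hrp : M ≤ Kerr.rPlus M a := by
    have := Real.sqrt_nonneg (M ^ 2 - a ^ 2)
    simp only [Kerr.rPlus]; linarith
  have hr0 : 0 < Kerr.radius a x := hM.trans_le (hrp.trans hr.le)
  unfold Kerr.scalarH
  rw [div_le_one (by positivity)]
  nlinarith [sq_nonneg (a * x 3), pow_pos hr0 3, hrp.trans hr.le]

/-- Pointwise upper comparison on the exterior for `0 < M` (any `a`): the height-`0` flux density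
`T[ψ](V, V)` is at most `15×` the cut-off coordinate energy density (`T(V,V) ≤ (2 + 5H + 8H²)
∑(∂ψ)²`, `Kerr.stressEnergy_timeVector_le_coordEnergyDensity`, and `0 ≤ H ≤ 1`). DRSR
arXiv:1402.7034, §3.1 (display following (23)). [folklore] -/
theorem leafFluxDensity_le_indicator_coordEnergyDensity_of_pos [Kerr.Facts] {M a : ℝ}
    (hM : 0 < M) (ψ : Kerr.region a (Kerr.rPlus M a) → ℝ) (τ : ℝ) (y : E3) :
    Kerr.leafFluxDensity M a 0 ψ τ y ≤
      15 * Set.indicator {y : E3 | E4.ofTimeSpace τ y ∈ Kerr.region a (Kerr.rPlus M a)}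
        (fun y ↦ ENNReal.ofReal
          (coordEnergyDensity (Kerr.region a (Kerr.rPlus M a)) ψ (E4.ofTimeSpace τ y))) y := by
  by_cases hmem : E4.ofTimeSpace τ y ∈ Kerr.region a (Kerr.rPlus M a)
  · rw [Set.indicator_of_mem
      (show y ∈ {y : E3 | E4.ofTimeSpace τ y ∈ Kerr.region a (Kerr.rPlus M a)} from hmem),
      Kerr.leafFluxDensity_zero_height_of_mem ψ τ hmem]
    have h1 := Kerr.stressEnergy_timeVector_le_coordEnergyDensity hM.le a (Kerr.rPlus M a) ψ
      ⟨E4.ofTimeSpace τ y, hmem⟩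
    have hH0 : 0 ≤ Kerr.scalarH M a (E4.ofTimeSpace τ y) := Kerr.scalarH_nonneg hM.le a _
    have hH1 : Kerr.scalarH M a (E4.ofTimeSpace τ y) ≤ 1 := scalarH_le_one_of_pos hM hmem
    have hd : 0 ≤ coordEnergyDensity (Kerr.region a (Kerr.rPlus M a)) ψ (E4.ofTimeSpace τ y) :=
      coordEnergyDensity_nonneg _ _ _
    have h2 : (Kerr.smoothMetric M a (Kerr.rPlus M a)).stressEnergy ψ ⟨E4.ofTimeSpace τ y, hmem⟩
        (Kerr.timeVector M a (E4.ofTimeSpace τ y)) (Kerr.timeVector M a (E4.ofTimeSpace τ y)) ≤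
        15 * coordEnergyDensity (Kerr.region a (Kerr.rPlus M a)) ψ (E4.ofTimeSpace τ y) := by
      refine h1.trans (mul_le_mul_of_nonneg_right ?_ hd)
      nlinarith
    calc ENNReal.ofReal ((Kerr.smoothMetric M a (Kerr.rPlus M a)).stressEnergy ψ
            ⟨E4.ofTimeSpace τ y, hmem⟩ (Kerr.timeVector M a (E4.ofTimeSpace τ y))
            (Kerr.timeVector M a (E4.ofTimeSpace τ y)))
        ≤ ENNReal.ofReal
            (15 * coordEnergyDensity (Kerr.region a (Kerr.rPlus M a)) ψ (E4.ofTimeSpace τ y)) :=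
          ENNReal.ofReal_le_ofReal h2
      _ = 15 * ENNReal.ofReal
            (coordEnergyDensity (Kerr.region a (Kerr.rPlus M a)) ψ (E4.ofTimeSpace τ y)) := by
          rw [ENNReal.ofReal_mul (by norm_num), ENNReal.ofReal_ofNat]
  · rw [Kerr.leafFluxDensity_zero_height_of_not_mem ψ τ hmem]
    exact zero_le

/-- **`E^N_{τ, Σ_τ ∩ {‖y‖ ≤ R}}(ψ) ≤ 15 · localSliceEnergy ψ τ R` on the exterior for `0 < M`**
(any `a`; the tree's `Kerr.localLeafFlux_zero_height_le_localSliceEnergy` assumes `|a| < M`):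
the local `N`-energy through a Kerr–Schild leaf is controlled by the local coordinate energy.
DRSR arXiv:1402.7034, §3.1 (display following (23)), §3.3. [folklore] -/
theorem localLeafFlux_zero_height_le_localSliceEnergy_of_pos [Kerr.Facts] {M a : ℝ}
    (hM : 0 < M) (ψ : Kerr.region a (Kerr.rPlus M a) → ℝ) (τ R : ℝ) :
    Kerr.localLeafFlux M a 0 ψ τ R ≤
      15 * localSliceEnergy (Kerr.region a (Kerr.rPlus M a)) ψ τ R := by
  rw [localSliceEnergy, Kerr.localLeafFlux,
    ← lintegral_const_mul' _ _ (ENNReal.ofNat_ne_top (n := 15))]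
  exact lintegral_mono fun y ↦ leafFluxDensity_le_indicator_coordEnergyDensity_of_pos hM ψ τ y

/-- From `ofReal p ≤ ofReal k · X` with `k > 0` conclude `ofReal (p / k) ≤ X` (`ℝ≥0∞` bookkeeping
for the comparability constants). [folklore] -/
theorem ofReal_div_le_of_le_mul {p k : ℝ} (hk : 0 < k) {X : ℝ≥0∞}
    (h : ENNReal.ofReal p ≤ ENNReal.ofReal k * X) : ENNReal.ofReal (p / k) ≤ X := by
  rw [ENNReal.ofReal_div_of_pos hk]
  exact ENNReal.div_le_of_le_mul' h

/-! ### Vanishing: where a wave vanishes identically it carries no energy -/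

variable {U : TopologicalSpace.Opens E4}

/-- A function on the chart that vanishes on an open set has zero manifold derivative there
(locality of `mfderiv`). [folklore] -/
theorem mfderiv_eq_zero_of_eqOn_zero {f : U → ℝ} {S : Set U} (hS : IsOpen S)
    (hf : ∀ x ∈ S, f x = 0) {x : U} (hx : x ∈ S) :
    mfderiv 𝓘(ℝ, E4) 𝓘(ℝ, ℝ) f x = 0 := by
  have h : f =ᶠ[𝓝 x] fun _ ↦ (0 : ℝ) := by
    filter_upwards [hS.mem_nhds hx] with z hz using hf z hz
  rw [h.mfderiv_eq]
  exact mfderiv_const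

/-- The set of chart points of spatial radius `> R` is open. [folklore] -/
theorem isOpen_lt_spatialNorm (R : ℝ) : IsOpen {x : U | R < E4.spatialNorm (x : E4)} := by
  have hc : Continuous fun x : U ↦ E4.spatialNorm (x : E4) := by
    unfold E4.spatialNorm
    fun_prop
  exact isOpen_lt continuous_const hc

/-- A wave vanishing at all chart points of spatial radius `≥ R` has vanishing value and
differential at every chart point of spatial radius `> R`. [folklore] -/
theorem eq_zero_and_mfderiv_eq_zero_of_vanishing {f : U → ℝ} {R : ℝ}
    (hf : ∀ x : U, R ≤ E4.spatialNorm (x : E4) → f x = 0) {x : U}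
    (hx : R < E4.spatialNorm (x : E4)) :
    f x = 0 ∧ mfderiv 𝓘(ℝ, E4) 𝓘(ℝ, ℝ) f x = 0 :=
  ⟨hf x hx.le, mfderiv_eq_zero_of_eqOn_zero (isOpen_lt_spatialNorm R)
    (fun z hz ↦ hf z (le_of_lt hz)) hx⟩

/-- `mvfderiv` is `mfderiv` read in the trivialisation of the tangent spaces of `ℝ` (Mathlib's
`NormedSpace.fromTangentSpace` is the identity). [folklore] -/
theorem mvfderiv_apply_eq_mfderiv (f : U → ℝ) (x : U) (w : E4) :
    mvfderiv 𝓘(ℝ, E4) f x w = mfderiv 𝓘(ℝ, E4) 𝓘(ℝ, ℝ) f x w :=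
  rfl

/-- Where the differential vanishes the stress–energy tensor vanishes (`T` is quadratic in `dψ`).
Dafermos–Rodnianski arXiv:0811.0354, §13 (App. D). [folklore] -/
theorem stressEnergy_eq_zero_of_mfderiv_eq_zero [Kerr.Facts] {M a r₀ : ℝ}
    {f : Kerr.region a r₀ → ℝ} {x : Kerr.region a r₀}
    (hx : mfderiv 𝓘(ℝ, E4) 𝓘(ℝ, ℝ) f x = 0) :
    (Kerr.smoothMetric M a r₀).stressEnergy f x = 0 := by
  have hmv : mvfderiv 𝓘(ℝ, E4) f x = 0 := by
    ext w
    rw [mvfderiv_apply_eq_mfderiv, hx]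
    rfl
  ext X Y
  simp [PseudoRiemannianMetric.stressEnergy_apply, PseudoRiemannianMetric.gradSq,
    PseudoRiemannianMetric.innerDual, hmv]

/-- **A wave vanishing outside the cylinder `{‖y‖ < R}` has all its `N`-energy in the ball**:
`E^N_τ(u) = E^N_{τ, Σ_τ ∩ {‖y‖ ≤ R}}(u)`. Bookkeeping for Sbierski's `supp ũ ⊆ 𝒩 ⊆ 𝒯`
(proofs of Thm. 5.1, Thm. 5.5). [folklore] -/
theorem leafFlux_zero_height_eq_localLeafFlux [Kerr.Facts] {M a R : ℝ}
    {u : Kerr.region a (Kerr.rPlus M a) → ℝ}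
    (hu : ∀ x : Kerr.region a (Kerr.rPlus M a), R ≤ E4.spatialNorm (x : E4) → u x = 0) (τ : ℝ) :
    Kerr.leafFlux M a 0 u τ = Kerr.localLeafFlux M a 0 u τ R := by
  rw [Kerr.leafFlux, Kerr.localLeafFlux,
    ← lintegral_add_compl _ Metric.isClosed_closedBall.measurableSet]
  suffices h : ∫⁻ y in (Metric.closedBall (0 : E3) R)ᶜ, Kerr.leafFluxDensity M a 0 u τ y = 0 by
    rw [h, add_zero]
  refine (setLIntegral_congr_fun Metric.isClosed_closedBall.measurableSet.compl ?_).trans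
    (lintegral_zero (μ := volume.restrict (Metric.closedBall (0 : E3) R)ᶜ))
  intro y hy
  rw [Set.mem_compl_iff, Metric.mem_closedBall, dist_zero_right, not_le] at hy
  by_cases hmem : E4.ofTimeSpace τ y ∈ Kerr.region a (Kerr.rPlus M a)
  · rw [Kerr.leafFluxDensity_zero_height_of_mem u τ hmem]
    have hx : R < E4.spatialNorm (E4.ofTimeSpace τ y) := by simpa using hy
    have hd := (eq_zero_and_mfderiv_eq_zero_of_vanishing hu
      (x := (⟨E4.ofTimeSpace τ y, hmem⟩ : Kerr.region a (Kerr.rPlus M a))) hx).2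
    rw [stressEnergy_eq_zero_of_mfderiv_eq_zero hd]
    simp
  · exact Kerr.leafFluxDensity_zero_height_of_not_mem u τ hmem

/-! ### Locality: functions agreeing near a point have the same `□_g` and the same energies -/

/-- If two functions on the chart agree near `x`, their zero extensions agree near `x` in `E4`
(the inclusion of the open set `U` is an open embedding). [folklore] -/
theorem extend_val_eventuallyEq {f g : U → ℝ} {x : U} (h : f =ᶠ[𝓝 x] g) :
    Function.extend Subtype.val f (0 : E4 → ℝ) =ᶠ[𝓝 (x : E4)]
      Function.extend Subtype.val g (0 : E4 → ℝ) := by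
  rw [← U.isOpen.isOpenEmbedding_subtypeVal.map_nhds_eq x]
  show ∀ᶠ y in Filter.map Subtype.val (𝓝 x), _
  rw [Filter.eventually_map]
  filter_upwards [h] with z hz
  rw [extend_val_apply, extend_val_apply, hz]

/-- **Locality of the wave operator on the Kerr chart**: `C²` functions agreeing near a point have
the same `□_g` there (chart formula `Kerr.dalembertian_extend_eq_sum`: `□_g` is a function of the
first two derivatives of the representative). O'Neill 1983, Ch. 3, Def. 3.50 ff.
[folklore] -/
theorem dalembertian_congr_of_eventuallyEq [Kerr.Facts] [Kerr.SliceFacts] {M a r₀ : ℝ}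
    {f g : Kerr.region a r₀ → ℝ} (hf : ContMDiff 𝓘(ℝ, E4) 𝓘(ℝ, ℝ) 2 f)
    (hg : ContMDiff 𝓘(ℝ, E4) 𝓘(ℝ, ℝ) 2 g) {x : Kerr.region a r₀} (h : f =ᶠ[𝓝 x] g) :
    (Kerr.smoothMetric M a r₀).toPseudoRiemannianMetric.dalembertian f x =
      (Kerr.smoothMetric M a r₀).toPseudoRiemannianMetric.dalembertian g x := by
  have hE := extend_val_eventuallyEq h
  rw [Kerr.dalembertian_extend_eq_sum M a r₀ hf x, Kerr.dalembertian_extend_eq_sum M a r₀ hg x,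
    hE.fderiv_eq, (hE.fderiv (𝕜 := ℝ)).fderiv_eq]

/-- Locality of the local coordinate energy: `C^n` functions (`n ≠ 0`) with the same differential
at every chart point of the leaf `{t* = τ}` have the same local energy through it (companion of
`sliceEnergy_congr_of_mfderiv_eq`). [folklore] -/
theorem localSliceEnergy_congr_of_mfderiv_eq {f g : U → ℝ} {n : ℕ∞ω} (hn : n ≠ 0)
    (hf : ContMDiff 𝓘(ℝ, E4) 𝓘(ℝ, ℝ) n f) (hg : ContMDiff 𝓘(ℝ, E4) 𝓘(ℝ, ℝ) n g) (τ R : ℝ)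
    (h : ∀ x : U, (x : E4) 0 = τ →
      mfderiv 𝓘(ℝ, E4) 𝓘(ℝ, ℝ) f x = mfderiv 𝓘(ℝ, E4) 𝓘(ℝ, ℝ) g x) :
    localSliceEnergy U f τ R = localSliceEnergy U g τ R := by
  unfold localSliceEnergy
  refine lintegral_congr fun y ↦ ?_
  by_cases hy : E4.ofTimeSpace τ y ∈ U
  · rw [Set.indicator_of_mem (show y ∈ {y : E3 | E4.ofTimeSpace τ y ∈ U} from hy),
      Set.indicator_of_mem (show y ∈ {y : E3 | E4.ofTimeSpace τ y ∈ U} from hy)]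
    exact congrArg ENNReal.ofReal (coordEnergyDensity_congr_of_mfderiv_eq hn hf hg ⟨_, hy⟩
      (h ⟨_, hy⟩ (E4.ofTimeSpace_apply_zero τ y)))
  · rw [Set.indicator_of_notMem (show y ∉ {y : E3 | E4.ofTimeSpace τ y ∈ U} from hy),
      Set.indicator_of_notMem (show y ∉ {y : E3 | E4.ofTimeSpace τ y ∈ U} from hy)]

/-- Locality of the slab norm: functions agreeing at the chart points of the slab `{0 ≤ t* ≤ T}`
have the same `slabSqNorm` over it. [folklore] -/
theorem slabSqNorm_congr_of_eqOn_slab {F G : U → ℝ} {T : ℝ}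
    (h : ∀ x : U, 0 ≤ (x : E4) 0 → (x : E4) 0 ≤ T → F x = G x) :
    slabSqNorm U F T = slabSqNorm U G T := by
  unfold slabSqNorm
  refine lintegral_congr fun y ↦ ?_
  by_cases hy : y ∈ {x : E4 | x ∈ (U : Set E4) ∧ 0 ≤ x 0 ∧ x 0 ≤ T}
  · rw [Set.indicator_of_mem hy, Set.indicator_of_mem hy]
    obtain ⟨hyU, hy0, hyT⟩ := hy
    rw [extend_val_apply F ⟨y, hyU⟩, extend_val_apply G ⟨y, hyU⟩, h ⟨y, hyU⟩ hy0 hyT]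
  · rw [Set.indicator_of_notMem hy, Set.indicator_of_notMem hy]

/-! ### The smooth cut-off in `t*` -/

/-- **The time cut-off** `χ_T(t) = σ(t + 2) σ(T + 2 − t)` with Mathlib's smooth transition
`σ = Real.smoothTransition` (`σ = 0` on `(−∞, 0]`, `σ = 1` on `[1, ∞)`): a `C^∞` function equal
to `1` on `[−1, T + 1]` and to `0` off `(−2, T + 2)`. [folklore] -/
def timeCutoff (T t : ℝ) : ℝ :=
  Real.smoothTransition (t + 2) * Real.smoothTransition (T + 2 - t)

/-- The time cut-off is smooth. [folklore] -/
theorem contDiff_timeCutoff (T : ℝ) : ContDiff ℝ ∞ (timeCutoff T) := by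
  unfold timeCutoff
  exact (Real.smoothTransition.contDiff.comp (contDiff_id.add contDiff_const)).mul
    (Real.smoothTransition.contDiff.comp (contDiff_const.sub contDiff_id))

/-- The time cut-off is `1` on `[−1, T + 1]`. [folklore] -/
theorem timeCutoff_eq_one {T t : ℝ} (h₁ : -1 ≤ t) (h₂ : t ≤ T + 1) : timeCutoff T t = 1 := by
  unfold timeCutoff
  rw [Real.smoothTransition.one_of_one_le (by linarith),
    Real.smoothTransition.one_of_one_le (by linarith), one_mul]

/-- The time cut-off vanishes for `t ≤ −2`. [folklore] -/
theorem timeCutoff_eq_zero_of_le {T t : ℝ} (h : t ≤ -2) : timeCutoff T t = 0 := by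
  unfold timeCutoff
  rw [Real.smoothTransition.zero_of_nonpos (by linarith), zero_mul]

/-- The time cut-off vanishes for `t ≥ T + 2`. [folklore] -/
theorem timeCutoff_eq_zero_of_ge {T t : ℝ} (h : T + 2 ≤ t) : timeCutoff T t = 0 := by
  unfold timeCutoff
  rw [Real.smoothTransition.zero_of_nonpos (sub_nonpos.2 h), mul_zero]

/-- The norm of a point of `E4` is at most `|t*| + ‖y‖`. [folklore] -/
theorem norm_le_abs_add_spatialNorm (y : E4) : ‖y‖ ≤ |y 0| + E4.spatialNorm y := by
  have hs : 0 ≤ E4.spatialNorm y := E4.spatialNorm_nonneg y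
  have hsq : ‖y‖ ^ 2 = y 0 ^ 2 + E4.spatialNorm y ^ 2 := by
    rw [EuclideanSpace.norm_sq_eq, Fin.sum_univ_four, E4.spatialNorm_sq]
    simp only [Real.norm_eq_abs, sq_abs]
    ring
  have hle : ‖y‖ ^ 2 ≤ (|y 0| + E4.spatialNorm y) ^ 2 := by
    rw [hsq]
    nlinarith [abs_nonneg (y 0), sq_abs (y 0)]
  exact (sq_le_sq₀ (norm_nonneg y) (by positivity)).1 hle

/-! ### The coordinate-energy beam fact from the literal one -/

/-- **`SbierskiKerrGaussianBeams` from `SbierskiKerrTrappedGeodesicBeams`.** Given `R ≥ R₀` let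
`e, c₁, C₁, δ` be as in the literal fact and put `c := c₁/30`, `C := 4C₁`. Given `T ≥ 0`, `ε > 0`
take the beam `u` for `μ := min(c₁/2, ε)` and cut it off in time, `v(x) := χ_T(t*(x)) u(x)`
(`timeCutoff`). Then `v` is `C^∞`; it vanishes off the compact subset
`{−2 ≤ t* ≤ T + 2} ∩ {‖y‖ ≤ R} ∩ {r ≥ r₊ + δ}` of the chart; it agrees with `u` on the open set
`{−1 < t* < T + 1}`, so `□v = □u` on the slab `{0 ≤ t* ≤ T}` (locality of `□_g`) and
`‖□v‖²_{L²(R_{[0,T]})} = ‖□u‖² ≤ μ ≤ ε`, `dv = du` on the leaves `0 ≤ τ ≤ T`; its data vanish on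
`{t* = 0} ∩ {‖y‖ > R}` with those of `u`; `sliceEnergy v 0 = sliceEnergy u 0 ≤ 4 E^N_0(u) =
4 e(0) ≤ C` (coercivity `Kerr.sliceEnergy_le_four_mul_leafFlux`); and for `0 ≤ τ ≤ T`,
`15 · localSliceEnergy v τ R = 15 · localSliceEnergy u τ R ≥ E^N_{τ,ball}(u) = E^N_τ(u) ≥
e(τ) − μ ≥ c₁/2`, i.e. `localSliceEnergy v τ R ≥ c₁/30 = c`. This is the bookkeeping the
docstring of `SbierskiKerrGaussianBeams` absorbs ("the beam cut off smoothly in `t*` outside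
`[−1, T + 1]`", "comparability constants absorbed", "`μ = ṫ*/2`"), after Sbierski's proof of
Thm. 5.1. [cite: Sbierski2015, Thm. 5.1 (proof) with §7A] -/
theorem SbierskiKerrGaussianBeams.of_trappedGeodesicBeams (hB : SbierskiKerrTrappedGeodesicBeams) :
    SbierskiKerrGaussianBeams := by
  intro _ _ M a hM ha₀ haM
  obtain ⟨R₀, hR₀⟩ := hB M a hM ha₀ haM
  refine ⟨R₀, fun R hR ↦ ?_⟩
  obtain ⟨e, c₁, C₁, δ, hc₁, hδ, hebd, hbeam⟩ := hR₀ R hR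
  refine ⟨c₁ / 30, 4 * C₁, by positivity, fun T hT ε hε ↦ ?_⟩
  -- Sbierski's accuracy
  set μ : ℝ := min (c₁ / 2) ε with hμ_def
  have hμ₀ : 0 < μ := lt_min (by positivity) hε
  have hμ₁ : μ ≤ c₁ / 2 := min_le_left _ _
  have hμ₂ : μ ≤ ε := min_le_right _ _
  obtain ⟨u, hu, hsupp, hbox, hE₀, hEτ⟩ := hbeam T hT μ hμ₀
  have hsuppR : ∀ x : Kerr.exterior M a, R ≤ E4.spatialNorm (x : E4) → u x = 0 :=
    fun x hx ↦ hsupp x (Or.inl hx)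
  -- ### the cut-off beam
  set v : Kerr.exterior M a → ℝ := fun x ↦ timeCutoff T ((x : E4) 0) * u x with hv_def
  -- representatives
  set Φu : E4 → ℝ := Function.extend Subtype.val u (0 : E4 → ℝ) with hΦu
  have hrep_u : ∀ y : Kerr.exterior M a, u y = Φu y := fun y ↦ (extend_val_apply u y).symm
  set Φv : E4 → ℝ := fun y ↦ timeCutoff T (y 0) * Φu y with hΦv
  have hrep_v : ∀ y : Kerr.exterior M a, v y = Φv y := fun y ↦ by
    simp only [hv_def, hΦv, hrep_u]
  -- smoothness
  have hv : ContMDiff 𝓘(ℝ, E4) 𝓘(ℝ, ℝ) ∞ v := by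
    intro y
    refine (OpensChart.contMDiffAt_iff y v Φv hrep_v).2 ?_
    have h1 : ContDiffAt ℝ ∞ (fun z : E4 ↦ timeCutoff T (z 0)) y :=
      ((contDiff_timeCutoff T).comp (Kerr.contDiff_coord 0)).contDiffAt
    exact h1.mul ((OpensChart.contMDiffAt_iff y u Φu hrep_u).1 (hu y))
  -- `v = u` near the slab
  have hvu : ∀ x : Kerr.exterior M a, -1 < (x : E4) 0 → (x : E4) 0 < T + 1 → v =ᶠ[𝓝 x] u := by
    intro x hx₁ hx₂
    have hO : IsOpen {z : Kerr.exterior M a | -1 < (z : E4) 0 ∧ (z : E4) 0 < T + 1} := by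
      have hc : Continuous fun z : Kerr.exterior M a ↦ (z : E4) 0 := by fun_prop
      exact (isOpen_lt continuous_const hc).inter (isOpen_lt hc continuous_const)
    filter_upwards [hO.mem_nhds ⟨hx₁, hx₂⟩] with z hz
    simp only [hv_def, timeCutoff_eq_one hz.1.le hz.2.le, one_mul]
  have hvu_mfderiv : ∀ x : Kerr.exterior M a, -1 < (x : E4) 0 → (x : E4) 0 < T + 1 →
      mfderiv 𝓘(ℝ, E4) 𝓘(ℝ, ℝ) v x = mfderiv 𝓘(ℝ, E4) 𝓘(ℝ, ℝ) u x :=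
    fun x hx₁ hx₂ ↦ (hvu x hx₁ hx₂).mfderiv_eq
  -- `v` vanishes off the cylinder, as `u` does
  have hvR : ∀ x : Kerr.exterior M a, R ≤ E4.spatialNorm (x : E4) → v x = 0 := fun x hx ↦ by
    simp only [hv_def, hsuppR x hx, mul_zero]
  have hinf : (∞ : ℕ∞ω) ≠ 0 := by simp
  refine ⟨v, hv, ?_, ?_, ?_, ?_, ?_⟩
  · -- ### compact support in the chart
    set K : Set E4 := {y : E4 | -2 ≤ y 0 ∧ y 0 ≤ T + 2 ∧ E4.spatialNorm y ≤ R ∧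
      Kerr.rPlus M a + δ ≤ Kerr.radius a y} with hK_def
    have hKsub : K ⊆ (Kerr.exterior M a : Set E4) := by
      intro y hy
      rw [SetLike.mem_coe, Kerr.mem_exterior, max_lt_iff]
      have hrp := rPlus_pos_of_pos hM a
      exact ⟨by linarith [hy.2.2.2], by linarith [hy.2.2.2]⟩
    have hKclosed : IsClosed K := by
      have hc0 : Continuous fun y : E4 ↦ y 0 := (Kerr.contDiff_coord 0 (n := 0)).continuous
      have hcs : Continuous fun y : E4 ↦ E4.spatialNorm y := by
        unfold E4.spatialNorm; fun_prop
      have hcr : Continuous fun y : E4 ↦ Kerr.radius a y := Kerr.continuous_radius a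
      refine (isClosed_le continuous_const hc0).inter ((isClosed_le hc0 continuous_const).inter
        ((isClosed_le hcs continuous_const).inter (isClosed_le continuous_const hcr)))
    have hKbdd : Bornology.IsBounded K := by
      refine (Metric.isBounded_closedBall (x := (0 : E4)) (r := T + 2 + |R|)).subset ?_
      intro y hy
      rw [Metric.mem_closedBall, dist_zero_right]
      have h0 : |y 0| ≤ T + 2 := abs_le.2 ⟨by linarith [hy.1], hy.2.1⟩
      have h1 : E4.spatialNorm y ≤ |R| := hy.2.2.1.trans (le_abs_self R)
      linarith [norm_le_abs_add_spatialNorm y]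
    have hKc : IsCompact K := Metric.isCompact_of_isClosed_isBounded hKclosed hKbdd
    refine ⟨Subtype.val ⁻¹' K, Topology.IsInducing.subtypeVal.isCompact_preimage' hKc
      (fun y hy ↦ ⟨⟨y, hKsub hy⟩, rfl⟩), fun x hx ↦ ?_⟩
    -- off `K` the cut-off beam vanishes
    simp only [Set.mem_preimage, hK_def, Set.mem_setOf_eq, not_and_or, not_le] at hx
    rcases hx with h | h | h | h
    · simp only [hv_def, timeCutoff_eq_zero_of_le h.le, zero_mul]
    · simp only [hv_def, timeCutoff_eq_zero_of_ge h.le, zero_mul]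
    · exact hvR x h.le
    · simp only [hv_def, hsupp x (Or.inr h), mul_zero]
  · -- ### data outside the ball
    intro x _ hxR
    exact eq_zero_and_mfderiv_eq_zero_of_vanishing hvR hxR
  · -- ### initial energy
    have hT1 : (0 : ℝ) < T + 1 := by linarith
    calc sliceEnergy (Kerr.exterior M a) v 0
        = sliceEnergy (Kerr.exterior M a) u 0 :=
          sliceEnergy_congr_of_mfderiv_eq hinf hv hu 0 fun x hx ↦
            hvu_mfderiv x (by rw [hx]; norm_num) (by rw [hx]; exact hT1)
      _ ≤ 4 * Kerr.leafFlux M a 0 u 0 := Kerr.sliceEnergy_le_four_mul_leafFlux hM.le u 0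
      _ = ENNReal.ofReal (4 * e 0) := by
          rw [hE₀, ENNReal.ofReal_mul (by norm_num), ENNReal.ofReal_ofNat]
      _ ≤ ENNReal.ofReal (4 * C₁) := ENNReal.ofReal_le_ofReal (by linarith [(hebd 0 le_rfl).2])
  · -- ### `‖□v‖² = ‖□u‖² ≤ μ ≤ ε` on the slab
    have heq : slabSqNorm (Kerr.exterior M a) (fun x ↦
          (Kerr.smoothMetric M a (Kerr.rPlus M a)).toPseudoRiemannianMetric.dalembertian v x) T =
        slabSqNorm (Kerr.exterior M a) (fun x ↦
          (Kerr.smoothMetric M a (Kerr.rPlus M a)).toPseudoRiemannianMetric.dalembertian u x) T :=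
      slabSqNorm_congr_of_eqOn_slab fun x hx0 hxT ↦
        dalembertian_congr_of_eventuallyEq (hv.of_le (by norm_cast))
          (hu.of_le (by norm_cast)) (hvu x (by linarith) (by linarith))
    rw [heq]
    exact hbox.trans (ENNReal.ofReal_le_ofReal hμ₂)
  · -- ### local energy on `[0, T]`
    intro τ hτ₀ hτT
    obtain ⟨hfin, habs⟩ := hEτ τ hτ₀ hτT
    have heτ : c₁ ≤ e τ := (hebd τ hτ₀).1
    have hloc : localSliceEnergy (Kerr.exterior M a) v τ R =
        localSliceEnergy (Kerr.exterior M a) u τ R :=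
      localSliceEnergy_congr_of_mfderiv_eq hinf hv hu τ R fun x hx ↦
        hvu_mfderiv x (by rw [hx]; linarith) (by rw [hx]; linarith)
    rw [hloc]
    -- the beam: `E^N_τ(u) ≥ e τ − μ ≥ c₁ / 2`, all of it inside the ball
    have hflux : ENNReal.ofReal (c₁ / 2) ≤ Kerr.localLeafFlux M a 0 u τ R := by
      rw [← leafFlux_zero_height_eq_localLeafFlux hsuppR τ, ← ENNReal.ofReal_toReal hfin]
      refine ENNReal.ofReal_le_ofReal ?_
      have := (abs_sub_lt_iff.1 habs).2
      linarith
    have h15 : ENNReal.ofReal (c₁ / 2) ≤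
        ENNReal.ofReal 15 * localSliceEnergy (Kerr.exterior M a) u τ R := by
      rw [ENNReal.ofReal_ofNat]
      exact hflux.trans (localLeafFlux_zero_height_le_localSliceEnergy_of_pos hM u τ R)
    have h := ofReal_div_le_of_le_mul (by norm_num : (0 : ℝ) < 15) h15
    convert h using 2
    ring

/-! ### Corollaries: the localised solutions and the barrier from (A) and the literal beam fact -/

/-- **Sbierski's localised solutions from the Cauchy problem and the literal beam fact**:
`KerrWaveCauchyEnergyEstimate` (Thm. 2.1's well-posedness and energy estimate) and
`SbierskiKerrTrappedGeodesicBeams` (§3–§4 beams along the §7A geodesic, in the source's `N`-energy)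
give `SbierskiKerrLocalisedSolutions`, through `SbierskiKerrGaussianBeams.of_trappedGeodesicBeams`
and the approximation argument `SbierskiKerrLocalisedSolutions.of_inputs`.
[cite: Sbierski2015, Thm. 5.1 (proof) with §7A] -/
theorem SbierskiKerrLocalisedSolutions.of_cauchy_of_beams
    (hA : KerrWaveCauchyEnergyEstimate) (hB : SbierskiKerrTrappedGeodesicBeams) :
    SbierskiKerrLocalisedSolutions :=
  SbierskiKerrLocalisedSolutions.of_inputs hA (SbierskiKerrGaussianBeams.of_trappedGeodesicBeams hB)

/-- The data-localised barrier `SbierskiTrappingObstruction` from (A) and the literal beam fact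
(Thm. 5.5 argument, `SbierskiTrappingObstruction.of_localisedSolutions`).
[cite: Sbierski2015, Thm. 5.5 and Thm. 5.1] -/
theorem SbierskiTrappingObstruction.of_cauchy_of_beams
    (hA : KerrWaveCauchyEnergyEstimate) (hB : SbierskiKerrTrappedGeodesicBeams) :
    SbierskiTrappingObstruction :=
  SbierskiTrappingObstruction.of_localisedSolutions
    (SbierskiKerrLocalisedSolutions.of_cauchy_of_beams hA hB)

/-- **Sbierski's Kerr trapping theorem (print-literal Thm. 7.4) from (A) and the literal beam
fact**, via the data-localised obstruction and `SbierskiTrappingObstruction.literal`.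
[cite: Sbierski2015, Thm. 7.4 via Thm. 5.5 and Thm. 5.1] -/
theorem SbierskiKerrTrappingLED.of_cauchy_of_beams
    (hA : KerrWaveCauchyEnergyEstimate) (hB : SbierskiKerrTrappedGeodesicBeams) :
    SbierskiKerrTrappingLED :=
  SbierskiTrappingObstruction.literal (SbierskiTrappingObstruction.of_cauchy_of_beams hA hB)

end Literature.Barriers.FinalStateConjecture

end
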